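import Summits.Ventures.PercRepro.ProfilePointedCircuitClassesInOutLYM
import Summits.Ventures.PercRepro.ProfileTwoTop

/-!
# PercRepro — THE SPANNING `5`-SETS OF `S ∪ Y` IN A RANK-`4` MATROID, III: THE PARALLEL PAIR INSIDE `S`
(p5, gen 41; `proofs/P5-GM1.md` §60)

`M` has rank `4` and no loops, `S` is a spanning `5`-set containing a PARALLEL PAIR `{s₁, s₂}` (`ρ{s₁, s₂} ≤ 1`), and
`K := S ∖ {s₁, s₂}` — then `K + s₁` is a basis (`rk_insert_sdiff_pair_eq_four`).  A point `z` with `ρ{s₁, z} ≤ 1`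
(a BAD point, parallel to the pair) substitutes for `s₁` in every rank: `ρ(X + z) = ρ(X + s₁)`
(`rk_insert_eq_of_parallel`).  The three hyperplanes `Π_m := cl(K − m + s₁)` through `s₁` meet pairwise in the lines
`cl{s₁, m}` (`four_add_rk_insert_pair_le`, submodularity), and a point `y` lying on all three is parallel to `s₁`:
so a NON-BAD `y` has some `m ∈ K` with `K − m + s₁ + y` spanning (`exists_mem_sdiff_rk_insert_eq_four`).  Hence
the point labels: every `y` has the two labels `s₁, s₂` (`two_le_card_filter_of_parallel_pair`) and a non-bad `y`
also the label `m` (`three_le_card_filter_of_parallel_pair_of_not`).  Two bad points `z, z'` form a dependent pair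
with the label `A = {s₁, s₂}` (`K + z + z'` spans: `one_le_card_filter_pair_of_bad`, `rk_pair_le_one_of_bad`).
-/

open scoped Matroid

namespace PercRepro.Cogirth

open Finset ThmH Skew Shadow Profile

variable {α : Type} [DecidableEq α] {M : Matroid α} [M.Finite]

section StarStarC

/-! ### Parallel substitution -/

/-- **Parallel substitution, two inserts**: for parallel `z, w` (`ρ{z, w} ≤ 1`, `w` not a loop),
`ρ(X + w + z) = ρ(X + w)`. -/
theorem rk_insert_insert_eq_of_parallel (hll : ∀ x ∈ gr M, rk M {x} = 1) {z w : α} (hw : w ∈ gr M)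
    (hzw : rk M {z, w} ≤ 1) (X : Finset α) :
    rk M (insert z (insert w X)) = rk M (insert w X) := by
  have h := rk_union_add_rk_inter_le (M := M) (insert w X) {z, w}
  have hu : insert w X ∪ {z, w} = insert z (insert w X) := by
    ext x
    simp only [mem_union, mem_insert, mem_singleton]
    tauto
  have hi : ({w} : Finset α) ⊆ insert w X ∩ {z, w} := by
    intro x hx
    rw [mem_singleton] at hx
    subst hx
    exact mem_inter.2 ⟨mem_insert_self _ _, mem_insert_of_mem (mem_singleton_self _)⟩
  have h1 := rk_mono' (M := M) hi
  rw [hll w hw] at h1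
  rw [hu] at h
  have h2 := rk_mono' (M := M) (subset_insert z (insert w X))
  omega

/-- **Parallel substitution**: for parallel `z, w` (both non-loops), `ρ(X + z) = ρ(X + w)`. -/
theorem rk_insert_eq_of_parallel (hll : ∀ x ∈ gr M, rk M {x} = 1) {z w : α} (hz : z ∈ gr M) (hw : w ∈ gr M)
    (hzw : rk M {z, w} ≤ 1) {X : Finset α} (hX : X ⊆ gr M) :
    rk M (insert z X) = rk M (insert w X) := by
  have h1 := rk_insert_insert_eq_of_parallel hll hw hzw X
  have h2 := rk_insert_insert_eq_of_parallel hll hz (by rw [pair_comm]; exact hzw) X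
  rw [insert_comm] at h2
  have _hX := hX
  omega

/-! ### The basis `K + s₁` -/

/-- `#(S ∖ {s₁, s₂}) = 3`. -/
theorem card_sdiff_pair {S : Finset α} (hS5 : S.card = 5) {s₁ s₂ : α} (hs₁ : s₁ ∈ S) (hs₂ : s₂ ∈ S)
    (hne : s₁ ≠ s₂) : (S \ {s₁, s₂}).card = 3 := by
  rw [card_sdiff_of_subset (insert_subset hs₁ (singleton_subset_iff.2 hs₂)), card_pair hne, hS5]

/-- **`K + s₁` spans**: `ρ(S ∖ {s₁, s₂} + s₁) = 4` when `{s₁, s₂} ⊆ S` is a parallel pair and `S` spans. -/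
theorem rk_insert_sdiff_pair_eq_four (hR : rk M (gr M) = 4) (hll : ∀ x ∈ gr M, rk M {x} = 1) {S : Finset α}
    (hS : S ⊆ gr M) (hSsp : rk M S = 4) {s₁ s₂ : α} (hs₁ : s₁ ∈ S) (hs₂ : s₂ ∈ S)
    (hpar : rk M {s₁, s₂} ≤ 1) :
    rk M (insert s₁ (S \ {s₁, s₂})) = 4 := by
  have h := rk_union_add_rk_inter_le (M := M) (insert s₁ (S \ {s₁, s₂})) {s₁, s₂}
  have hu : insert s₁ (S \ {s₁, s₂}) ∪ {s₁, s₂} = S := by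
    ext x
    simp only [mem_union, mem_insert, mem_sdiff, mem_singleton, not_or]
    constructor
    · rintro ((h | ⟨hx, _⟩) | h | h)
      · rw [h]; exact hs₁
      · exact hx
      · rw [h]; exact hs₁
      · rw [h]; exact hs₂
    · intro hx
      by_cases h1 : x = s₁
      · exact Or.inl (Or.inl h1)
      by_cases h2 : x = s₂
      · exact Or.inr (Or.inr h2)
      exact Or.inl (Or.inr ⟨hx, h1, h2⟩)
  have hi : ({s₁} : Finset α) ⊆ insert s₁ (S \ {s₁, s₂}) ∩ {s₁, s₂} := by
    intro x hx
    rw [mem_singleton] at hx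
    subst hx
    exact mem_inter.2 ⟨mem_insert_self _ _, mem_insert_self _ _⟩
  have h1 := rk_mono' (M := M) hi
  rw [hll s₁ (hS hs₁)] at h1
  rw [hu] at h
  have h2 : rk M (insert s₁ (S \ {s₁, s₂})) ≤ rk M (gr M) :=
    rk_le_rk_gr (insert_subset (hS hs₁) ((sdiff_subset (s := S) (t := {s₁, s₂})).trans hS))
  omega

/-- Subsets of the basis `K + s₁` are independent. -/
theorem rk_eq_card_of_subset_insert_sdiff_pair (hR : rk M (gr M) = 4) (hll : ∀ x ∈ gr M, rk M {x} = 1)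
    {S : Finset α} (hS : S ⊆ gr M) (hS5 : S.card = 5) (hSsp : rk M S = 4) {s₁ s₂ : α} (hs₁ : s₁ ∈ S)
    (hs₂ : s₂ ∈ S) (hne : s₁ ≠ s₂) (hpar : rk M {s₁, s₂} ≤ 1) {X : Finset α}
    (hX : X ⊆ insert s₁ (S \ {s₁, s₂})) : rk M X = X.card := by
  apply rk_eq_card_of_subset_of_rk_eq_card hX
  rw [rk_insert_sdiff_pair_eq_four hR hll hS hSsp hs₁ hs₂ hpar, card_insert_of_notMem,
    card_sdiff_pair hS5 hs₁ hs₂ hne]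
  rw [mem_sdiff, not_and, not_not]
  intro _
  exact mem_insert_self _ _

/-! ### The three hyperplanes through `s₁` -/

/-- **Two of the hyperplanes through `s₁` meet in a line**: for distinct `k, l ∈ K` and the third point `m`,
`4 + ρ(y + s₁ + m) ≤ ρ(y + s₁ + (K − k)) + ρ(y + s₁ + (K − l))` (submodularity: the union contains the basis
`K + s₁`, the intersection contains `{y, s₁, m}`). -/
theorem four_add_rk_insert_pair_le (hR : rk M (gr M) = 4) (hll : ∀ x ∈ gr M, rk M {x} = 1) {S : Finset α}
    (hS : S ⊆ gr M) (hSsp : rk M S = 4) {s₁ s₂ : α} (hs₁ : s₁ ∈ S) (hs₂ : s₂ ∈ S) (hpar : rk M {s₁, s₂} ≤ 1)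
    {k l m : α} (hm : m ∈ S \ {s₁, s₂}) (hkl : k ≠ l) (hmk : m ≠ k) (hml : m ≠ l) (y : α) :
    4 + rk M (insert y {s₁, m}) ≤ rk M (insert y (insert s₁ ((S \ {s₁, s₂}).erase k))) +
      rk M (insert y (insert s₁ ((S \ {s₁, s₂}).erase l))) := by
  have h := rk_union_add_rk_inter_le (M := M) (insert y (insert s₁ ((S \ {s₁, s₂}).erase k)))
    (insert y (insert s₁ ((S \ {s₁, s₂}).erase l)))
  have hu : insert s₁ (S \ {s₁, s₂}) ⊆ insert y (insert s₁ ((S \ {s₁, s₂}).erase k)) ∪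
      insert y (insert s₁ ((S \ {s₁, s₂}).erase l)) := by
    intro x hx
    rw [mem_insert] at hx
    rw [mem_union, mem_insert, mem_insert, mem_insert, mem_insert, mem_erase, mem_erase]
    rcases hx with h | hx
    · exact Or.inl (Or.inr (Or.inl h))
    · by_cases hxk : x = k
      · exact Or.inr (Or.inr (Or.inr ⟨by rw [hxk]; exact hkl, hx⟩))
      · exact Or.inl (Or.inr (Or.inr ⟨hxk, hx⟩))
  have hi : insert y {s₁, m} ⊆ insert y (insert s₁ ((S \ {s₁, s₂}).erase k)) ∩
      insert y (insert s₁ ((S \ {s₁, s₂}).erase l)) := by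
    intro x hx
    rw [mem_insert, mem_insert, mem_singleton] at hx
    rw [mem_inter, mem_insert, mem_insert, mem_erase, mem_insert, mem_insert, mem_erase]
    rcases hx with h | h | h
    · exact ⟨Or.inl h, Or.inl h⟩
    · exact ⟨Or.inr (Or.inl h), Or.inr (Or.inl h)⟩
    · rw [h]
      exact ⟨Or.inr (Or.inr ⟨hmk, hm⟩), Or.inr (Or.inr ⟨hml, hm⟩)⟩
  have h1 := rk_mono' (M := M) hu
  have h2 := rk_mono' (M := M) hi
  have h3 := rk_insert_sdiff_pair_eq_four hR hll hS hSsp hs₁ hs₂ hpar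
  omega

/-- **A non-bad point misses one of the three hyperplanes**: if `ρ{s₁, y} > 1` then some `m ∈ K` has
`K − m + s₁ + y` spanning (a point on all three hyperplanes `Π_m` lies on `cl{s₁, m}` for every `m`, hence
on `cl{s₁}`). -/
theorem exists_mem_sdiff_rk_insert_eq_four (hR : rk M (gr M) = 4) (hll : ∀ x ∈ gr M, rk M {x} = 1)
    {S : Finset α} (hS : S ⊆ gr M) (hS5 : S.card = 5) (hSsp : rk M S = 4) {s₁ s₂ : α} (hs₁ : s₁ ∈ S)
    (hs₂ : s₂ ∈ S) (hne : s₁ ≠ s₂) (hpar : rk M {s₁, s₂} ≤ 1) {y : α} (hy : y ∈ gr M)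
    (hyb : ¬ rk M {s₁, y} ≤ 1) :
    ∃ m ∈ S \ {s₁, s₂}, rk M (insert y (insert s₁ ((S \ {s₁, s₂}).erase m))) = 4 := by
  by_contra hcon
  simp only [not_exists, not_and] at hcon
  have hK3 := card_sdiff_pair hS5 hs₁ hs₂ hne
  obtain ⟨a, b, c, hab, hac, hbc, hKabc⟩ := card_eq_three.1 hK3
  have haK : a ∈ S \ {s₁, s₂} := by rw [hKabc]; exact mem_insert_self _ _
  have hbK : b ∈ S \ {s₁, s₂} := by rw [hKabc]; exact mem_insert_of_mem (mem_insert_self _ _)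
  have hcK : c ∈ S \ {s₁, s₂} := by
    rw [hKabc]; exact mem_insert_of_mem (mem_insert_of_mem (mem_singleton_self _))
  have hle : ∀ m ∈ S \ {s₁, s₂}, rk M (insert y (insert s₁ ((S \ {s₁, s₂}).erase m))) ≤ 3 := by
    intro m hm
    have h4 : rk M (insert y (insert s₁ ((S \ {s₁, s₂}).erase m))) ≤ rk M (gr M) :=
      rk_le_rk_gr (insert_subset hy (insert_subset (hS hs₁)
        ((erase_subset _ _).trans (sdiff_subset.trans hS))))
    have := hcon m hm
    omega
  have hH := four_add_rk_insert_pair_le hR hll hS hSsp hs₁ hs₂ hpar hcK hab hac.symm hbc.symm y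
  have ha3 := hle a haK
  have hb3 := hle b hbK
  have hc3 := hle c hcK
  -- the line `cl{s₁, c}` meets the hyperplane `Π_c` in `cl{s₁}`
  have h := rk_union_add_rk_inter_le (M := M) (insert y {s₁, c})
    (insert y (insert s₁ ((S \ {s₁, s₂}).erase c)))
  have hu : insert s₁ (S \ {s₁, s₂}) ⊆ insert y {s₁, c} ∪ insert y (insert s₁ ((S \ {s₁, s₂}).erase c)) := by
    intro x hx
    rw [mem_insert] at hx
    rw [mem_union, mem_insert, mem_insert, mem_singleton, mem_insert, mem_insert, mem_erase]
    rcases hx with h | hx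
    · exact Or.inl (Or.inr (Or.inl h))
    · by_cases hxc : x = c
      · exact Or.inl (Or.inr (Or.inr hxc))
      · exact Or.inr (Or.inr (Or.inr ⟨hxc, hx⟩))
  have hi : ({s₁, y} : Finset α) ⊆ insert y {s₁, c} ∩ insert y (insert s₁ ((S \ {s₁, s₂}).erase c)) := by
    intro x hx
    rw [mem_insert, mem_singleton] at hx
    rw [mem_inter, mem_insert, mem_insert, mem_singleton, mem_insert, mem_insert, mem_erase]
    rcases hx with h | h
    · exact ⟨Or.inr (Or.inl h), Or.inr (Or.inl h)⟩
    · exact ⟨Or.inl h, Or.inl h⟩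
  have h1 := rk_mono' (M := M) hu
  have h2 := rk_mono' (M := M) hi
  have h3 := rk_insert_sdiff_pair_eq_four hR hll hS hSsp hs₁ hs₂ hpar
  exact hyb (by omega)

/-! ### The point labels -/

/-- **The label `s₁`**: `(S − s₁) + y ⊇ K + s₂` spans (`s₂` substitutes for `s₁`). -/
theorem s₁_mem_filter_of_parallel_pair (hR : rk M (gr M) = 4) (hll : ∀ x ∈ gr M, rk M {x} = 1)
    {S : Finset α} (hS : S ⊆ gr M) (hSsp : rk M S = 4) {s₁ s₂ : α} (hs₁ : s₁ ∈ S) (hs₂ : s₂ ∈ S)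
    (hne : s₁ ≠ s₂) (hpar : rk M {s₁, s₂} ≤ 1) {y : α} (hy : y ∈ gr M) :
    s₁ ∈ S.filter (fun s => rk M (insert y (S.erase s)) = 4) := by
  have hK4 := rk_insert_sdiff_pair_eq_four hR hll hS hSsp hs₁ hs₂ hpar
  have hKg : S \ {s₁, s₂} ⊆ gr M := sdiff_subset.trans hS
  have h4 : rk M (insert y (S.erase s₁)) ≤ rk M (gr M) :=
    rk_le_rk_gr (insert_subset hy ((erase_subset s₁ S).trans hS))
  rw [mem_filter]
  refine ⟨hs₁, ?_⟩
  have hsub : insert s₂ (S \ {s₁, s₂}) ⊆ insert y (S.erase s₁) := by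
    intro g hg
    rw [mem_insert] at hg
    rw [mem_insert, mem_erase]
    rcases hg with h | hg
    · exact Or.inr ⟨by rw [h]; exact hne.symm, by rw [h]; exact hs₂⟩
    · rw [mem_sdiff, mem_insert, mem_singleton, not_or] at hg
      exact Or.inr ⟨hg.2.1, hg.1⟩
  have h1 := rk_mono' (M := M) hsub
  have h2 := rk_insert_eq_of_parallel hll (hS hs₂) (hS hs₁) (by rw [pair_comm]; exact hpar) hKg
  omega

/-- **The label `s₂`**: `(S − s₂) + y ⊇ K + s₁` spans. -/
theorem s₂_mem_filter_of_parallel_pair (hR : rk M (gr M) = 4) (hll : ∀ x ∈ gr M, rk M {x} = 1)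
    {S : Finset α} (hS : S ⊆ gr M) (hSsp : rk M S = 4) {s₁ s₂ : α} (hs₁ : s₁ ∈ S) (hs₂ : s₂ ∈ S)
    (hne : s₁ ≠ s₂) (hpar : rk M {s₁, s₂} ≤ 1) {y : α} (hy : y ∈ gr M) :
    s₂ ∈ S.filter (fun s => rk M (insert y (S.erase s)) = 4) := by
  have hK4 := rk_insert_sdiff_pair_eq_four hR hll hS hSsp hs₁ hs₂ hpar
  have h4 : rk M (insert y (S.erase s₂)) ≤ rk M (gr M) :=
    rk_le_rk_gr (insert_subset hy ((erase_subset s₂ S).trans hS))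
  rw [mem_filter]
  refine ⟨hs₂, ?_⟩
  have hsub : insert s₁ (S \ {s₁, s₂}) ⊆ insert y (S.erase s₂) := by
    intro g hg
    rw [mem_insert] at hg
    rw [mem_insert, mem_erase]
    rcases hg with h | hg
    · exact Or.inr ⟨by rw [h]; exact hne, by rw [h]; exact hs₁⟩
    · rw [mem_sdiff, mem_insert, mem_singleton, not_or] at hg
      exact Or.inr ⟨hg.2.2, hg.1⟩
  have h1 := rk_mono' (M := M) hsub
  omega

/-- **The labels `s₁, s₂`**: every point `y` has at least two point labels. -/
theorem two_le_card_filter_of_parallel_pair (hR : rk M (gr M) = 4) (hll : ∀ x ∈ gr M, rk M {x} = 1)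
    {S : Finset α} (hS : S ⊆ gr M) (hSsp : rk M S = 4) {s₁ s₂ : α} (hs₁ : s₁ ∈ S) (hs₂ : s₂ ∈ S)
    (hne : s₁ ≠ s₂) (hpar : rk M {s₁, s₂} ≤ 1) {y : α} (hy : y ∈ gr M) :
    2 ≤ (S.filter (fun s => rk M (insert y (S.erase s)) = 4)).card := by
  have hsub : ({s₁, s₂} : Finset α) ⊆ S.filter (fun s => rk M (insert y (S.erase s)) = 4) := by
    rw [insert_subset_iff, singleton_subset_iff]
    exact ⟨s₁_mem_filter_of_parallel_pair hR hll hS hSsp hs₁ hs₂ hne hpar hy,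
      s₂_mem_filter_of_parallel_pair hR hll hS hSsp hs₁ hs₂ hne hpar hy⟩
  calc 2 = ({s₁, s₂} : Finset α).card := (card_pair hne).symm
    _ ≤ _ := card_le_card hsub

/-- **The third label of a non-bad point**: the `m ∈ K` with `K − m + s₁ + y` spanning is a point label of `y`,
so a non-bad `y` has at least three. -/
theorem three_le_card_filter_of_parallel_pair_of_not (hR : rk M (gr M) = 4) (hll : ∀ x ∈ gr M, rk M {x} = 1)
    {S : Finset α} (hS : S ⊆ gr M) (hS5 : S.card = 5) (hSsp : rk M S = 4) {s₁ s₂ : α} (hs₁ : s₁ ∈ S)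
    (hs₂ : s₂ ∈ S) (hne : s₁ ≠ s₂) (hpar : rk M {s₁, s₂} ≤ 1) {y : α} (hy : y ∈ gr M)
    (hyb : ¬ rk M {s₁, y} ≤ 1) :
    3 ≤ (S.filter (fun s => rk M (insert y (S.erase s)) = 4)).card := by
  obtain ⟨m, hm, hm4⟩ := exists_mem_sdiff_rk_insert_eq_four hR hll hS hS5 hSsp hs₁ hs₂ hne hpar hy hyb
  have hmS : m ∈ S := (mem_sdiff.1 hm).1
  have hm12 : m ∉ ({s₁, s₂} : Finset α) := (mem_sdiff.1 hm).2
  have hm1 : m ≠ s₁ := fun h => hm12 (h ▸ mem_insert_self _ _)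
  have hmm : m ∈ S.filter (fun s => rk M (insert y (S.erase s)) = 4) := by
    rw [mem_filter]
    refine ⟨hmS, ?_⟩
    have h4 : rk M (insert y (S.erase m)) ≤ rk M (gr M) :=
      rk_le_rk_gr (insert_subset hy ((erase_subset m S).trans hS))
    have hsub : insert y (insert s₁ ((S \ {s₁, s₂}).erase m)) ⊆ insert y (S.erase m) := by
      intro g hg
      rw [mem_insert, mem_insert, mem_erase, mem_sdiff] at hg
      rw [mem_insert, mem_erase]
      rcases hg with h | h | ⟨hgm, hgS, _⟩
      · exact Or.inl h
      · exact Or.inr ⟨by rw [h]; exact hm1.symm, by rw [h]; exact hs₁⟩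
      · exact Or.inr ⟨hgm, hgS⟩
    have h1 := rk_mono' (M := M) hsub
    omega
  have hsub3 : insert m ({s₁, s₂} : Finset α) ⊆ S.filter (fun s => rk M (insert y (S.erase s)) = 4) := by
    rw [insert_subset_iff, insert_subset_iff, singleton_subset_iff]
    exact ⟨hmm, s₁_mem_filter_of_parallel_pair hR hll hS hSsp hs₁ hs₂ hne hpar hy,
      s₂_mem_filter_of_parallel_pair hR hll hS hSsp hs₁ hs₂ hne hpar hy⟩
  have hcard3 : (insert m ({s₁, s₂} : Finset α)).card = 3 := by
    rw [card_insert_of_notMem hm12, card_pair hne]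
  calc 3 = (insert m ({s₁, s₂} : Finset α)).card := hcard3.symm
    _ ≤ _ := card_le_card hsub3

/-! ### Two bad points -/

/-- Two bad points are parallel: `ρ{z, z'} ≤ 1`. -/
theorem rk_pair_le_one_of_bad (hll : ∀ x ∈ gr M, rk M {x} = 1) {s₁ z z' : α} (hs₁ : s₁ ∈ gr M)
    (hz : z ∈ gr M) (hz' : z' ∈ gr M) (hzb : rk M {s₁, z} ≤ 1) (hz'b : rk M {s₁, z'} ≤ 1) :
    rk M {z, z'} ≤ 1 := by
  have h := rk_insert_eq_of_parallel hll hz hs₁ (by rw [pair_comm]; exact hzb)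
    (X := {z'}) (singleton_subset_iff.2 hz')
  rw [h]
  exact hz'b

/-- **The label `{s₁, s₂}` of two bad points**: `K + z + z'` spans (`z, z'` substitute for `s₁`). -/
theorem one_le_card_filter_pair_of_bad (hR : rk M (gr M) = 4) (hll : ∀ x ∈ gr M, rk M {x} = 1) {S : Finset α}
    (hS : S ⊆ gr M) (hSsp : rk M S = 4) {s₁ s₂ : α} (hs₁ : s₁ ∈ S) (hs₂ : s₂ ∈ S) (hne : s₁ ≠ s₂)
    (hpar : rk M {s₁, s₂} ≤ 1) {z z' : α} (hz : z ∈ gr M) (hz' : z' ∈ gr M) (hzb : rk M {s₁, z} ≤ 1)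
    (hz'b : rk M {s₁, z'} ≤ 1) :
    1 ≤ ((S.powersetCard 2).filter (fun A => rk M ((S \ A) ∪ {z, z'}) = 4)).card := by
  apply card_pos.2
  refine ⟨{s₁, s₂}, ?_⟩
  rw [mem_filter, mem_powersetCard]
  refine ⟨⟨insert_subset hs₁ (singleton_subset_iff.2 hs₂), card_pair hne⟩, ?_⟩
  have hKg : S \ {s₁, s₂} ⊆ gr M := sdiff_subset.trans hS
  have e : (S \ {s₁, s₂}) ∪ {z, z'} = insert z (insert z' (S \ {s₁, s₂})) := by
    ext x
    simp only [mem_union, mem_insert, mem_singleton]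
    tauto
  rw [e, rk_insert_eq_of_parallel hll hz (hS hs₁) (by rw [pair_comm]; exact hzb) (insert_subset hz' hKg),
    insert_comm, rk_insert_eq_of_parallel hll hz' (hS hs₁) (by rw [pair_comm]; exact hz'b)
      (insert_subset (hS hs₁) hKg), insert_eq_of_mem (mem_insert_self s₁ (S \ {s₁, s₂}))]
  exact rk_insert_sdiff_pair_eq_four hR hll hS hSsp hs₁ hs₂ hpar

end StarStarC

end PercRepro.Cogirth
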